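import Summits.BirchSwinnertonDyer.BirchSwinnertonDyer.Theses.SemiOrdinaryEisensteinDescent
import Summits.BirchSwinnertonDyer.BirchSwinnertonDyer.Theorems.SemiOrdinaryEisensteinDescentWildKolyvaginUpperAtThreeOfPrimitives
import Literature.NumberTheory.EllipticCurves.HeegnerPointsOfConductorRationalityProofs
import Literature.NumberTheory.EllipticCurves.HeegnerPointsRationalityProofs
import HarnessLib

/-!
# Route `SemiOrdinaryEisensteinDescent`, crux J `WildSigmaDivisibilityAtThree` (stmt-BirchSwinnertonDyer-20760) — and through it Ko
# `WildKolyvaginUpperAtThree` (stmt-20480, line `birth` v3, `stub_sigma` = J): the MANIN SLACK ISOLATED IN THE KERNEL —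
# J ⟸ J♭ (J on data with `3 ∤ c(Dt)`: Jetchev's Σ-form PROPER) + a MANIN SCALING statement («every parametrisation datum of a curve
# of the cell is an integer multiple of one whose Manin constant is prime to `3`» = the `3`-part of Manin's conjecture for the optimal
# curve at `27 ∣ N`), by DATUM SCALING (lead prover bsd-wall-soed-p2 g2; `--supports`, helper; BSD is not proved by any of this)

WHY (memo `Cruxes/WildKolyvaginUpperAtThree/MANIN-SHADOW-lead-g2.md`). J (and Ko) are «Manin-robust»: their depth/slack carries
`v₃ c(Dt)`, the `3`-part of the Manin constant of the parametrisation datum `Dt`. That makes them TRUE for every datum (BSD + Gross–Zagier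
predict EQUALITY at that slack), but on the Euler-system road it is an extra PROOF obligation: the Kolyvagin system of Heegner points sees
`E(K[n])` only, not `c`. This file proves the exact bookkeeping behind that statement: scaling a datum's constant `c = k·c′` (same newform,
same uniformisation) scales every Heegner point of every conductor, every derived point `P(n)`, and hence the depth, by `k`; so J for ALL data
follows from J on data with `3 ∤ c` (there `v₃ c = 0` and J is Jetchev's Conj. 1.3 Σ-form with NO Manin term) together with the statement
that every datum IS such a multiple — which, given the geometry of `X₀(N) → E_opt → W` (no rational `3`-isogeny when `ρ̄₃` is onto), is
equivalent to `3 ∤ c_opt` for the optimal curve of the class: the `3`-part of Manin's conjecture, OPEN IN PRINT at `27 ∣ N`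
(Česnavičius–Neururer–Saha Thm. 1.2 needs `3 ∤ deg φ₀`; `3 ∣ deg φ₀` on all 3 894 classes of the onto wild rank-one row, census
MANIN-HABITAT-v1; `c_opt = 1` there only by Cremona's finite verification). The CM inputs of the transport (the `K[n]`-rationality of
`φ(x(n))` and the `K`-rationality of `y_K`) are the tree's PROVED theorems `phi_heegnerPointOfConductor_mem_range_map_ringClassField_holds`,
`heegnerPointComplex_mem_range_map_holds` (Darmon 2004 Thm. 3.6), so the reduction is unconditional.

WHAT IS PROVED (no definition, no named fact, no `sorry`; CONDITIONAL on the two displayed hypotheses, nothing asserted about any curve):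
* `φ_eq_zsmul_of_scaling`, `heegnerPointComplex_eq_zsmul_of_scaling`, `heegnerPointComplexOfConductor_eq_zsmul_of_scaling` — the analytic
  scaling `φ_{k c′} = k·φ_{c′}` on `ℍ`, on the traced Heegner point and on the CM points of every conductor;
* `derivedPoint_zsmul` — Kolyvagin's derivative is `ℤ`-linear: `P_{σ,S}(k·y) = k·P_{σ,S}(y)`;
* `exists_scaled_kolyvaginHeegnerData` — along `c = k·c′` every Kolyvagin–Heegner datum `d` for `Dt` has a companion `d′` for `Dt′`
  (same `σ_ℓ`, `S`, embedding; `y′` supplied by Darmon Thm. 3.6 PROVED) with `d.derivedPoint = k • d′.derivedPoint`;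
* `wildKolyvaginUpperAtThree_of_flat_of_maninScaling_of_primitives` — the crux Ko BY NAME from J♭ + ManinScaling₃ + Kolyvagin Thm. A +
  {Cassels–Tate level inputs, Gross 3.7 (2), GZ86 III (3.1)} (composition with lead g2's p581112): Ko's line `birth` v3 with its research
  stub split into (Jetchev Σ-form proper) ⊕ (Manin₃).
* **`wildSigmaDivisibilityAtThree_of_flat_of_maninScaling : J♭ → ManinScaling₃ → J`** — J BY NAME, where J♭ is J's text VERBATIM with
  ONE extra binder `¬ (3 : ℤ) ∣ Dt.c` and ManinScaling₃ is displayed (curve-level binders of J; `∃ Dt′ k, Dt′.f = Dt.f ∧ Dt′.uniformize =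
  Dt.uniformize ∧ Dt.c = k * Dt′.c ∧ ¬ 3 ∣ Dt′.c`). Depth bookkeeping: `s′ ≤ ord₃ ∏ c_ℓ + v₃(k c′) = ord₃ ∏ c_ℓ + v₃ k`; if `s′ ≤ v₃ k` the
  divisibility is free (`P(n) = k·P′(n)`), else J♭ at depth `s′ − v₃ k ≤ ord₃ ∏ c_ℓ` on `d′` and `k·3^{s′−v₃k}·Q′ = 3^{s′}·(k/3^{v₃k})·Q′`.
So the research content of J = `stub_sigma` of Ko's line splits as (Büyükboduk 2009 §4.2 Q1 at 3 = J♭ beyond the max-form) ⊕ (Manin₃); a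
planner may file ManinScaling₃ as a support item (precedent: route AdditiveKolyvaginRoad's `¬ p ∣ Dt.c` frames and crux
`ManinFrameResidueProper`) with this theorem as the glue. References: [Jetchev2008] Rem. 1.2, Conj. 1.3 (p. 812); [GrossZagier1986] I §6,
V (2.2); [CesnaviciusNeururerSaha2023] Thm. 1.2; [AgasheRibetStein2006] Thm. 2.7; [Cremona ANTS VII 2006] §3.8 Thm. 1; [Darmon2004] Thm. 3.6;
[GrossLMS1991] §3 (x_n rational over K_n), §4 (4.1); [WZhang2014] §3.7.
-/

set_option autoImplicit false
set_option linter.dupNamespace false -- `Summit.BirchSwinnertonDyer.BirchSwinnertonDyer.…` is the tree's layout (D-0017)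

noncomputable section

open scoped Classical

namespace Summit.BirchSwinnertonDyer.BirchSwinnertonDyer.Theorems.WildSigmaDivisibilityAtThreeOfFlatOfManinScaling

open WeierstrassCurve NumberField Literature.NumberTheory.EllipticCurves
  Literature.NumberTheory.EllipticCurves.ModularForms
  Summit.BirchSwinnertonDyer.Rank1Residual
  Summit.BirchSwinnertonDyer.Rank1Residual.Additive
  Summit.BirchSwinnertonDyer.Rank1Residual.X11b.Three
  Summit.BirchSwinnertonDyer.BirchSwinnertonDyer.Theses.SemiOrdinaryEisensteinDescent

/-! ## §1 Analytic scaling of a parametrisation datum -/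

section Scaling

variable {N : ℕ} [NeZero N] {W : WeierstrassCurve ℚ}

/-- **`φ_{Dt} = k·φ_{Dt′}` on `ℍ`** when the two data share the newform and the uniformisation and `c(Dt) = k·c(Dt′)`:
`φ(τ) = uniformize(c·∫_{i∞}^τ 2πi f)` and `uniformize : ℂ →+ E(ℂ)` is additive. [folklore] -/
theorem φ_eq_zsmul_of_scaling {Dt Dt' : ModularParametrizationData W N} {k : ℤ} (hf : Dt'.f = Dt.f)
    (hu : Dt'.uniformize = Dt.uniformize) (hc : Dt.c = k * Dt'.c) (τ : UpperHalfPlane) :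
    Dt.φ τ = k • Dt'.φ τ := by
  unfold ModularParametrizationData.φ
  rw [hu, hf, hc, Int.cast_mul, mul_assoc, ← zsmul_eq_mul, map_zsmul]

/-- **The traced Heegner point scales: `y(Dt) = k·y(Dt′)` in `E(ℂ)`** (sum over the same representatives `H.reps`). [folklore] -/
theorem heegnerPointComplex_eq_zsmul_of_scaling {Dt Dt' : ModularParametrizationData W N} {k : ℤ} (hf : Dt'.f = Dt.f)
    (hu : Dt'.uniformize = Dt.uniformize) (hc : Dt.c = k * Dt'.c) {D : ℤ} (H : HeegnerDatum N D) :
    heegnerPointComplex Dt H = k • heegnerPointComplex Dt' H := by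
  unfold heegnerPointComplex
  rw [Finset.smul_sum]
  exact Finset.sum_congr rfl fun Q _ ↦ φ_eq_zsmul_of_scaling hf hu hc _

/-- **The CM point of conductor `n` scales: `y_n(Dt) = k·y_n(Dt′)` in `E(ℂ)`.** [folklore] -/
theorem heegnerPointComplexOfConductor_eq_zsmul_of_scaling {Dt Dt' : ModularParametrizationData W N} {k : ℤ}
    (hf : Dt'.f = Dt.f) (hu : Dt'.uniformize = Dt.uniformize) (hc : Dt.c = k * Dt'.c) (D β : ℤ) (n : ℕ) :
    heegnerPointComplexOfConductor Dt D β n = k • heegnerPointComplexOfConductor Dt' D β n := by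
  unfold heegnerPointComplexOfConductor
  exact φ_eq_zsmul_of_scaling hf hu hc _

end Scaling

/-! ## §2 Kolyvagin's derivative is `ℤ`-linear -/

section Linear

variable {G : Type*} [Monoid G] {A : Type*} [AddCommGroup A] (ρ : G →* AddMonoid.End A)

/-- `D_ℓ(k·y) = k·D_ℓ(y)`. [folklore] -/
private theorem derivOp_zsmul (σ : G) (ℓ : ℕ) (k : ℤ) (y : A) :
    KolyvaginOperator.derivOp ρ σ ℓ (k • y) = k • KolyvaginOperator.derivOp ρ σ ℓ y := by
  unfold KolyvaginOperator.derivOp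
  rw [Finset.smul_sum]
  exact Finset.sum_congr rfl fun i _ ↦ by rw [map_zsmul, smul_comm]

/-- `D_L(k·y) = k·D_L(y)` along a list of primes. [folklore] -/
private theorem derivOpProd_zsmul (σ : ℕ → G) (L : List ℕ) (k : ℤ) (y : A) :
    KolyvaginOperator.derivOpProd ρ σ L (k • y) = k • KolyvaginOperator.derivOpProd ρ σ L y := by
  induction L with
  | nil => rfl
  | cons ℓ L ih => rw [KolyvaginOperator.derivOpProd_cons, KolyvaginOperator.derivOpProd_cons, ih, derivOp_zsmul]

/-- **`P_{σ,S,n}(k·y) = k·P_{σ,S,n}(y)`**: the derived point `Σ_{s ∈ S} s(D_n y)` is `ℤ`-linear in `y`. [folklore] -/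
theorem derivedPoint_zsmul (σ : ℕ → G) (n : ℕ) (S : Finset G) (k : ℤ) (y : A) :
    KolyvaginOperator.derivedPoint ρ σ n S (k • y) = k • KolyvaginOperator.derivedPoint ρ σ n S y := by
  unfold KolyvaginOperator.derivedPoint
  rw [Finset.smul_sum]
  exact Finset.sum_congr rfl fun s _ ↦ by rw [derivOpProd_zsmul, map_zsmul]

end Linear

/-! ## §3 Transport of Kolyvagin–Heegner data along `c = k·c′` -/

section Transport

variable {N : ℕ} [NeZero N] {W : WeierstrassCurve ℚ} {K : Type} [Field K] [NumberField K]

/-- **Companion datum along a scaling.** For `E/ℚ` elliptic, `K` imaginary quadratic Heegner for `N`, data `Dt`, `Dt′` at level `N` with the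
same newform and uniformisation and `c(Dt) = k·c(Dt′)`, and a Kolyvagin–Heegner datum `d` of square-free conductor `n` prime to `N` on the frame
`(Dt, β, ι)`: there is a datum `d′` on `(Dt′, β, ι)` with the SAME generators `σ_ℓ`, transversal `S` and embedding, whose point `y′(n) ∈ E(K[n])`
is Darmon's (Thm. 3.6, PROVED in the tree: `phi_heegnerPointOfConductor_mem_range_map_ringClassField_holds`), and then `y(n) = k·y′(n)`
(injectivity of `E(K[n]) → E(ℂ)`) and `P(n) = k·P′(n)` (§2). [cite: Darmon2004, Thm. 3.6 (PDF pp. 43–44)] [cite: GrossLMS1991, §4 (4.1)] -/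
theorem exists_scaled_kolyvaginHeegnerData [W.IsElliptic] (hK : IsImaginaryQuadratic K)
    (hH : SatisfiesHeegnerHypothesis N K) {Dt Dt' : ModularParametrizationData W N} {k : ℤ}
    (hf : Dt'.f = Dt.f) (hu : Dt'.uniformize = Dt.uniformize) (hc : Dt.c = k * Dt'.c) {β : ℤ} {ι : K →+* ℂ}
    {n : ℕ} (hn0 : n ≠ 0) (hcop : Nat.Coprime n N) (d : KolyvaginHeegnerData Dt β ι n) :
    ∃ d' : KolyvaginHeegnerData Dt' β ι n, d.derivedPoint = k • d'.derivedPoint := by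
  obtain ⟨y', hy'⟩ := phi_heegnerPointOfConductor_mem_range_map_ringClassField_holds N W K hK hH Dt' β ι n
    d.dvd_sq_sub hn0 hcop
  refine ⟨{ dvd_sq_sub := d.dvd_sq_sub, y := y', map_y := hy', σ := d.σ, zpowers_σ := d.zpowers_σ, S := d.S,
            S_subset := d.S_subset, S_transversal := d.S_transversal, emb := d.emb, emb_apply := d.emb_apply }, ?_⟩
  have hy : d.y = k • y' := by
    apply WeierstrassCurve.Affine.Point.map_injective (W' := W) (ringClassField K ι n).subtype.toRatAlgHom
    rw [map_zsmul, d.map_y, hy', heegnerPointComplexOfConductor_eq_zsmul_of_scaling hf hu hc]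
  change KolyvaginOperator.derivedPoint _ d.σ n d.S d.y = k • KolyvaginOperator.derivedPoint _ d.σ n d.S y'
  rw [hy, derivedPoint_zsmul]

end Transport

/-! ## §4 J ⟸ J♭ + Manin scaling -/

/-- **J `WildSigmaDivisibilityAtThree` BY NAME ⟸ J♭ (J on data with `3 ∤ c(Dt)`) + ManinScaling₃.** `hFlat` is J's text VERBATIM with ONE
extra binder `¬ (3 : ℤ) ∣ Dt.c` (under which the Manin term `padicValNat 3 Dt.c.natAbs` of the depth is `0`: Jetchev's Conj. 1.3 Σ-form with
NO Manin content); `hScal` says that every datum of a curve of the cell is, analytically, an integer multiple `c = k·c′` of a datum with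
`3 ∤ c′` (⟺ `3 ∤ c_opt`, the `3`-part of Manin's conjecture at `27 ∣ N`, given the geometry of the optimal quotient — NOT proved here, a
displayed hypothesis). Proof: datum scaling (§§1–3, CM inputs PROVED in the tree) and the depth bookkeeping of the module docstring.
CONDITIONAL on both hypotheses; J, Ko, Manin's conjecture and BSD stay open. [cite: Jetchev2008, Rem. 1.2 and Conj. 1.3 (p. 812)]
[cite: CesnaviciusNeururerSaha2023, Thm. 1.2] [cite: Darmon2004, Thm. 3.6] -/
theorem wildSigmaDivisibilityAtThree_of_flat_of_maninScaling
    (hFlat : ∀ (W : WeierstrassCurve ℚ) [W.IsElliptic] [W.IsGloballyMinimal] (N : ℕ) [NeZero N] (K : Type)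
      [Field K] [NumberField K] (Dt : ModularParametrizationData W N)
      (H : HeegnerDatum N (NumberField.discr K)) (ι : K →+* ℂ) (P : (W.baseChange K).toAffine.Point),
      ClassO6 W 3 → W.HasSurjectiveModNGaloisRep 3 → W.analyticRank = 1 → W.conductorNorm ℤ = N →
      IsImaginaryQuadratic K → SatisfiesHeegnerHypothesis N K →
      (W.quadraticTwist (NumberField.discr K : ℚ)).entireLFunction 1 ≠ 0 →
      WeierstrassCurve.Affine.Point.map ι.toRatAlgHom P = heegnerPointComplex Dt H →
      ¬ IsOfFinAddOrder P → Odd (NumberField.discr K) → NumberField.discr K ≠ -3 →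
      AdditiveThree.TowerSurjThree W → ¬ (3 : ℤ) ∣ Dt.c →
      ∀ (s' : ℕ), s' ≤ padicValNat 3 W.tamagawaProduct + padicValNat 3 Dt.c.natAbs →
        ∀ (n : ℕ) (d : KolyvaginHeegnerData Dt H.β ι n), Squarefree n →
          (∀ ℓ ∈ n.primeFactors, Zhang2014.IsKolyvaginPrime N W K 3 ℓ ∧
            s' ≤ Zhang2014.kolyvaginIndex W 3 ℓ) → Koly.PDiv d 3 s')
    (hScal : ∀ (W : WeierstrassCurve ℚ) [W.IsElliptic] [W.IsGloballyMinimal] (N : ℕ) [NeZero N],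
      ClassO6 W 3 → W.HasSurjectiveModNGaloisRep 3 → W.analyticRank = 1 → W.conductorNorm ℤ = N →
      ∀ (Dt : ModularParametrizationData W N), ∃ (Dt' : ModularParametrizationData W N) (k : ℤ),
        Dt'.f = Dt.f ∧ Dt'.uniformize = Dt.uniformize ∧ Dt.c = k * Dt'.c ∧ ¬ (3 : ℤ) ∣ Dt'.c) :
    WildSigmaDivisibilityAtThree := by
  intro W _ _ N _ K _ _ Dt H ι P hO6 hsurj hr hN hK hHH hL hP hnt hodd h3 htower s' hs' n d hn hℓ
  haveI : Fact (Nat.Prime 3) := ⟨Nat.prime_three⟩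
  obtain ⟨Dt', k, hf, hu, hc, hc'⟩ := hScal W N hO6 hsurj hr hN Dt
  -- the `K`-rational Heegner point of `Dt′` (Darmon Thm. 3.6, PROVED) and `P = k·P′`
  obtain ⟨P', hP'⟩ := heegnerPointComplex_mem_range_map_holds N W K hK hHH Dt' H ι
  have hPk : P = k • P' := by
    apply WeierstrassCurve.Affine.Point.map_injective (W' := W) ι.toRatAlgHom
    rw [map_zsmul, hP, hP', heegnerPointComplex_eq_zsmul_of_scaling hf hu hc]
  have hnt' : ¬ IsOfFinAddOrder P' := fun h ↦ hnt (hPk ▸ h.zsmul)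
  have hk0 : k ≠ 0 := by
    rintro rfl
    exact hnt (by rw [hPk, zero_smul]; exact IsOfFinAddOrder.zero)
  -- `v₃(c(Dt)) = v₃(k)`
  set v := padicValNat 3 k.natAbs with hv
  have hc'0 : Dt'.c ≠ 0 := by rintro h; exact hc' (h ▸ dvd_zero 3)
  have hvc : padicValNat 3 Dt.c.natAbs = v := by
    rw [hc, Int.natAbs_mul, padicValNat.mul (Int.natAbs_ne_zero.mpr hk0) (Int.natAbs_ne_zero.mpr hc'0),
      padicValNat.eq_zero_of_not_dvd (fun h ↦ hc' (Int.natCast_dvd.mpr h)), add_zero]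
  -- `3^v ∣ k`
  obtain ⟨m, hm⟩ : ((3 ^ v : ℕ) : ℤ) ∣ k := Int.natCast_dvd.mpr pow_padicValNat_dvd
  -- the companion datum `d′` with `P(n) = k·P′(n)`
  have hn0 : n ≠ 0 := hn.ne_zero
  have hcop : Nat.Coprime n N := Nat.coprime_of_dvd fun q hq hqn hqN ↦
    (hℓ q (Nat.mem_primeFactors.mpr ⟨hq, hqn, hn0⟩)).1.2.1 hqN
  obtain ⟨d', hd'⟩ := exists_scaled_kolyvaginHeegnerData hK hHH hf hu hc hn0 hcop d
  by_cases hsv : s' ≤ v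
  · -- free: `3^{s′} ∣ k`
    obtain ⟨m', hm'⟩ : ((3 ^ s' : ℕ) : ℤ) ∣ k :=
      (Int.natCast_dvd_natCast.mpr (pow_dvd_pow 3 hsv)).trans ⟨m, hm⟩
    exact ⟨m' • d'.derivedPoint, by rw [← mul_smul, ← hm', hd']⟩
  · -- J♭ at depth `s′ − v ≤ ord₃ ∏ c_ℓ` on `d′`
    push Not at hsv
    have hb : s' - v ≤ padicValNat 3 W.tamagawaProduct + padicValNat 3 Dt'.c.natAbs := by omega
    have hℓ' : ∀ ℓ ∈ n.primeFactors, Zhang2014.IsKolyvaginPrime N W K 3 ℓ ∧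
        s' - v ≤ Zhang2014.kolyvaginIndex W 3 ℓ := fun ℓ hℓn ↦
      ⟨(hℓ ℓ hℓn).1, le_trans (Nat.sub_le _ _) (hℓ ℓ hℓn).2⟩
    obtain ⟨Q', hQ'⟩ := hFlat W N K Dt' H ι P' hO6 hsurj hr hN hK hHH hL hP' hnt' hodd h3 htower hc' (s' - v) hb
      n d' hn hℓ'
    refine ⟨m • Q', ?_⟩
    have hpow : ((3 ^ s' : ℕ) : ℤ) * m = k * ((3 ^ (s' - v) : ℕ) : ℤ) := by
      have h3 : (3 : ℤ) ^ s' = 3 ^ v * 3 ^ (s' - v) := by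
        rw [← pow_add, Nat.add_sub_cancel' hsv.le]
      rw [hm]; push_cast
      rw [h3]; ring
    rw [← mul_smul, hpow, mul_smul, hQ', hd']

/-! ## §5 Ko ⟸ J♭ + Manin scaling + primitive print -/

/-- **Crux Ko `WildKolyvaginUpperAtThree` BY NAME ⟸ J♭ + ManinScaling₃ + Kolyvagin 1990 Thm. A + {Cassels–Tate level inputs, Gross 1991
Prop. 3.7 (2), GZ86 III (3.1)}** — §4 composed with lead g2's primitive-print road
`WildKolyvaginUpperAtThreeOfPrimitives.wildKolyvaginUpperAtThree_of_sigma_of_primitives` (p581112: w2's McCallum road over bsd-stepL's kernel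
derivation of McCallum's Cor. 5.6 under the crux's tower binder). This is line `birth` v3 with its research stub `stub_sigma` (= J) SPLIT into
Jetchev's Σ-form proper (`hFlat`) and the Manin₃ scaling statement (`hScal`). CONDITIONAL on all six displayed hypotheses; Ko, J, Manin's
conjecture and BSD stay open. [cite: Jetchev2008, Conj. 1.3 (p. 812)] [cite: McCallumLMS1991, §5 Cor. 5.6 (p. 310)]
[cite: CesnaviciusNeururerSaha2023, Thm. 1.2] -/
theorem wildKolyvaginUpperAtThree_of_flat_of_maninScaling_of_primitives
    (hFlat : ∀ (W : WeierstrassCurve ℚ) [W.IsElliptic] [W.IsGloballyMinimal] (N : ℕ) [NeZero N] (K : Type)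
      [Field K] [NumberField K] (Dt : ModularParametrizationData W N)
      (H : HeegnerDatum N (NumberField.discr K)) (ι : K →+* ℂ) (P : (W.baseChange K).toAffine.Point),
      ClassO6 W 3 → W.HasSurjectiveModNGaloisRep 3 → W.analyticRank = 1 → W.conductorNorm ℤ = N →
      IsImaginaryQuadratic K → SatisfiesHeegnerHypothesis N K →
      (W.quadraticTwist (NumberField.discr K : ℚ)).entireLFunction 1 ≠ 0 →
      WeierstrassCurve.Affine.Point.map ι.toRatAlgHom P = heegnerPointComplex Dt H →
      ¬ IsOfFinAddOrder P → Odd (NumberField.discr K) → NumberField.discr K ≠ -3 →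
      AdditiveThree.TowerSurjThree W → ¬ (3 : ℤ) ∣ Dt.c →
      ∀ (s' : ℕ), s' ≤ padicValNat 3 W.tamagawaProduct + padicValNat 3 Dt.c.natAbs →
        ∀ (n : ℕ) (d : KolyvaginHeegnerData Dt H.β ι n), Squarefree n →
          (∀ ℓ ∈ n.primeFactors, Zhang2014.IsKolyvaginPrime N W K 3 ℓ ∧
            s' ≤ Zhang2014.kolyvaginIndex W 3 ℓ) → Koly.PDiv d 3 s')
    (hScal : ∀ (W : WeierstrassCurve ℚ) [W.IsElliptic] [W.IsGloballyMinimal] (N : ℕ) [NeZero N],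
      ClassO6 W 3 → W.HasSurjectiveModNGaloisRep 3 → W.analyticRank = 1 → W.conductorNorm ℤ = N →
      ∀ (Dt : ModularParametrizationData W N), ∃ (Dt' : ModularParametrizationData W N) (k : ℤ),
        Dt'.f = Dt.f ∧ Dt'.uniformize = Dt.uniformize ∧ Dt.c = k * Dt'.c ∧ ¬ (3 : ℤ) ∣ Dt'.c)
    (hKo : ∀ (N : ℕ) [NeZero N] (W : WeierstrassCurve ℚ) (K : Type) [Field K] [NumberField K],
      kolyvagin N W K)
    (hCT : ∀ (K : Type) [Field K] [NumberField K], casselsTate_levelInputs K)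
    (h372 : GrossLMS1991.prop37_2_frobeniusCongruence)
    (hE0 : Gross1991_heegnerPoint_sub_ratTorsion_mem_E0) :
    WildKolyvaginUpperAtThree :=
  WildKolyvaginUpperAtThreeOfPrimitives.wildKolyvaginUpperAtThree_of_sigma_of_primitives
    (wildSigmaDivisibilityAtThree_of_flat_of_maninScaling hFlat hScal) hKo hCT h372 hE0

end Summit.BirchSwinnertonDyer.BirchSwinnertonDyer.Theorems.WildSigmaDivisibilityAtThreeOfFlatOfManinScaling

end
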